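import Literature.NumberTheory.EllipticCurves.TwoIsogenyDescentIndex
import Literature.NumberTheory.EllipticCurves.TianYuanZhang2017.RhoIndexTorsionClasses
import Literature.NumberTheory.EllipticCurves.TianYuanZhang2017.GenusDescentEnSide
import HarnessLib

/-!
# Crux `PrintCf2.RamifiedOffTYZOfFacts` (stmt-BirchSwinnertonDyer-20509), line `offtyz-v7`, LEAD cycle 21 (cruxlead-20509 g20), part 2/3:
# THE `x`-CLASS `α` ON `E_n(ℚ)` AND TIAN–YUAN–ZHANG'S `ρ(n)`: `#α(E_n(ℚ)) = 4 · 2^{ρ(n)}` ON THE RANK-ONE LEAF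

THEOREMS ONLY (no `def`, no named fact, no `sorry`), `--supports stmt-BirchSwinnertonDyer-20509`.  HONEST FRAMING: descent bookkeeping on
the tree's `x`-class `α = xSqClass` (Silverman–Tate §3.5, `TwoIsogenyDescentAlpha/Index`) and the tree's `rhoSubgroup n = φ_n(A_n(ℚ)) + E_n[2]`
(`2^{ρ(n)} = (rhoSubgroup n).index`, Tian–Yuan–Zhang 2017 §1; `RhoIndexTorsionClasses`).  Nothing about BSD is asserted.

* `xSqClass_eq_sqClass_descentRep` — the tree's two `x (mod ℚ^{×2})` maps on `E_n(ℚ)` agree.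
* `natCard_range_xSqClass_le_four_of_rhoIndex_eq_one` — `ρ(n) = 0 ⟹ #α(E_n(ℚ)) ≤ 4`.
* `sqClass_torsion_injective`, `exists_two_torsion_xSqClass_eq`, `four_le_natCard_range_xSqClass` — for square-free `n > 1` the four
  torsion classes `1, [−1], [n], [−n]` are distinct and attained by `O, (0,0), (±n,0)`, so `#α(E_n(ℚ)) ≥ 4`.
* `mem_rhoSubgroup_of_xSqClass_torsion` — a point whose class is a torsion class lies in `φ_n(A_n(ℚ)) + E_n[2]`.
* `natCard_range_xSqClass_eq_of_rank_one` — **for square-free `n > 1` with `rank E_n(ℚ) = 1`: `#α(E_n(ℚ)) = 4` if `ρ(n) = 0` and `= 8`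
  if `ρ(n) ≠ 0`** (`#α ∣ 2^{rank+2}`).
Beyond-print theorem: NO.  BSD is not proved by any of this; C⁺ (item 23431) and the crux stay OPEN.

References: [cite: TianYuanZhang2017, §1 (p0002 L101–L110: ρ(n))]; [cite: SilvermanTate2015, §3.5 (α), §3.6 (2^r = #α#ᾱ/4)];
[cite: SilvermanAEC2009, Prop. X.1.4, Prop. X.4.9]; tree: `TwoIsogenyDescentAlpha`, `TwoIsogenyDescentIndex`, `RhoIndexTorsionClasses`.
-/

noncomputable section

open scoped Classical

open WeierstrassCurve Literature.NumberTheory.EllipticCurves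

namespace Summit.BirchSwinnertonDyer.PrintCf2.PartnerSha

/-! ## §4 The `x`-class `α` on `E_n(ℚ)` and the index `2^{ρ(n)} = [E_n(ℚ) : φ_n(A_n(ℚ)) + E_n[2]]` -/

open WeierstrassCurve.Affine WeierstrassCurve.Affine.Point
  Literature.NumberTheory.EllipticCurves.TwoDescentLocal
  Literature.NumberTheory.EllipticCurves.TianYuanZhang2017
  Literature.NumberTheory.EllipticCurves.TianYuanZhang2017.RhoMonskyKernel

/-- The tree's `x`-class `α = xSqClass` of `E_n` (Silverman–Tate §3.5, file `TwoIsogenyDescentAlpha`) IS the square class of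
the `2`-descent component `descentRep 0 (−n) n` used by `RhoIndexTorsionClasses` (both read `x (mod ℚ^{×2})`, with
`(0,0) ↦ [−n²]`, `O ↦ 1`). [cite: SilvermanTate2015, §3.5] [cite: SilvermanAEC2009, Prop. X.1.4] -/
theorem xSqClass_eq_sqClass_descentRep (n : ℕ) (P : (congruentNumberCurve n).toAffine.Point) :
    (congruentNumberCurve n).xSqClass P = sqClass (descentRep 0 (-(n : ℚ)) n P) := by
  rcases P with _ | ⟨x, y, hP⟩
  · change (congruentNumberCurve n).xSqClass 0 = sqClass (descentRep 0 (-(n : ℚ)) n 0)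
    rw [xSqClass_zero, descentRep_zero, show (1 : ℚ) = 1 ^ 2 by norm_num, sqClass_sq]
  · by_cases hx : x = 0
    · rw [xSqClass_some_of_eq_zero hP hx, descentRep_some_of_eq hP hx, congruentNumberCurve_a₄]
      congr 1
      ring
    · rw [xSqClass_some_of_ne_zero hP hx, descentRep_some_of_ne hP hx, sub_zero]

/-- **`ρ(n) = 0 ⟹ #α(E_n(ℚ)) ≤ 4`**: if `φ_n(A_n(ℚ)) + E_n[2] = E_n(ℚ)` then every `x`-class lies in
`{1, [−1], [n], [−n]}` (`sqClass_descentRep_of_mem_rhoSubgroup`). [cite: TianYuanZhang2017, §1 (ρ(n))] [cite: SilvermanAEC2009, Prop. X.4.9] -/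
theorem natCard_range_xSqClass_le_four_of_rhoIndex_eq_one {n : ℕ} (hn : n ≠ 0) (h : (rhoSubgroup n).index = 1) :
    Nat.card (Set.range (congruentNumberCurve n).xSqClass) ≤ 4 := by
  have htop : rhoSubgroup n = ⊤ := AddSubgroup.index_eq_one.mp h
  set T : Finset (SqUnits ℚ) := {1, sqClass (-1 : ℚ), sqClass (n : ℚ), sqClass (-(n : ℚ))} with hT
  have hsub : Set.range (congruentNumberCurve n).xSqClass ⊆ (T : Set (SqUnits ℚ)) := by
    rintro _ ⟨P, rfl⟩
    have hP := sqClass_descentRep_of_mem_rhoSubgroup hn (P := P) (by rw [htop]; exact AddSubgroup.mem_top P)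
    rw [xSqClass_eq_sqClass_descentRep]
    simpa only [hT, Finset.coe_insert, Finset.coe_singleton, Set.mem_insert_iff, Set.mem_singleton_iff] using hP
  calc Nat.card (Set.range (congruentNumberCurve n).xSqClass)
      ≤ Nat.card (T : Set (SqUnits ℚ)) := Nat.card_mono (Finset.finite_toSet T) hsub
    _ = T.card := by rw [Nat.card_coe_set_eq, Set.ncard_coe_finset]
    _ ≤ 4 := by
        rw [hT]
        refine (Finset.card_insert_le _ _).trans ?_
        refine (Nat.succ_le_succ (Finset.card_insert_le _ _)).trans ?_
        refine (Nat.succ_le_succ (Nat.succ_le_succ (Finset.card_insert_le _ _))).trans ?_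
        rw [Finset.card_singleton]

/-- For square-free `n > 1`: `−1`, `n`, `−n` are not rational squares, so the classes `1, [−1], [n], [−n]` are pairwise
distinct. [folklore] -/
theorem sqClass_torsion_injective {n : ℕ} (hsq : Squarefree n) (hn1 : 1 < n) :
    sqClass (-1 : ℚ) ≠ 1 ∧ sqClass (n : ℚ) ≠ 1 ∧ sqClass (-(n : ℚ)) ≠ 1 ∧
      sqClass (-1 : ℚ) ≠ sqClass (n : ℚ) ∧ sqClass (-1 : ℚ) ≠ sqClass (-(n : ℚ)) ∧
      sqClass (n : ℚ) ≠ sqClass (-(n : ℚ)) := by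
  have hn0 : (n : ℚ) ≠ 0 := by exact_mod_cast (show n ≠ 0 by omega)
  -- `−1` and `−n` are negative, hence not squares
  have hneg1 : sqClass (-1 : ℚ) ≠ 1 := by
    rw [Ne, sqClass_eq_one_iff (by norm_num)]
    rintro ⟨u, hu⟩
    nlinarith [sq_nonneg u]
  have hnegn : sqClass (-(n : ℚ)) ≠ 1 := by
    rw [Ne, sqClass_eq_one_iff (neg_ne_zero.mpr hn0)]
    rintro ⟨u, hu⟩
    have : (0 : ℚ) < n := by exact_mod_cast (show 0 < n by omega)
    nlinarith [sq_nonneg u]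
  -- `n` square-free and `> 1` is not a rational square
  have hnn : sqClass (n : ℚ) ≠ 1 := by
    rw [Ne, sqClass_eq_one_iff hn0]
    rintro ⟨u, hu⟩
    have hsqQ : IsSquare (n : ℚ) := ⟨u, by rw [hu]; ring⟩
    obtain ⟨m, hm⟩ := Rat.isSquare_natCast_iff.mp hsqQ
    have hmu : IsUnit m := (hm ▸ hsq) m (dvd_refl _)
    rw [Nat.isUnit_iff] at hmu
    subst hmu
    omega
  -- products: `[−1][n] = [−n]`
  have hmul : sqClass (-1 : ℚ) * sqClass (n : ℚ) = sqClass (-(n : ℚ)) := by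
    rw [← sqClass_mul (by norm_num) hn0, neg_one_mul]
  refine ⟨hneg1, hnn, hnegn, ?_, ?_, ?_⟩
  · intro h
    apply hnegn
    rw [← hmul, h, SqUnits.mul_self]
  · intro h
    apply hnn
    have : sqClass (-1 : ℚ) * sqClass (-1 : ℚ) = sqClass (-1 : ℚ) * sqClass (-(n : ℚ)) := by rw [← h]
    rw [SqUnits.mul_self, ← hmul, ← mul_assoc, SqUnits.mul_self, one_mul] at this
    exact this.symm
  · intro h
    apply hneg1
    have : sqClass (n : ℚ) * sqClass (n : ℚ) = sqClass (n : ℚ) * sqClass (-(n : ℚ)) := by rw [← h]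
    rw [SqUnits.mul_self, ← hmul, mul_comm (sqClass (-1 : ℚ)), ← mul_assoc, SqUnits.mul_self, one_mul] at this
    exact this.symm

/-- A rational point `(x, 0)` of `E_n` is `2`-torsion. [folklore] -/
theorem two_nsmul_some_zero {n : ℕ} {x : ℚ} (h : (congruentNumberCurve n).toAffine.Nonsingular x 0) :
    (2 : ℕ) • (Point.some x 0 h : (congruentNumberCurve n).toAffine.Point) = 0 := by
  rw [two_nsmul, Point.add_self_of_Y_eq]
  simp [negY]

/-- **The four torsion classes are attained by `2`-torsion points**: each of `1, [−1], [n], [−n]` is `α(Q)` for a rational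
point `Q` with `2Q = O` (`O`, `(0,0)`, `(n,0)`, `(−n,0)`). [cite: SilvermanTate2015, §3.5] -/
theorem exists_two_torsion_xSqClass_eq {n : ℕ} (hn : n ≠ 0) {c : SqUnits ℚ}
    (hc : c = 1 ∨ c = sqClass (-1 : ℚ) ∨ c = sqClass (n : ℚ) ∨ c = sqClass (-(n : ℚ))) :
    ∃ Q : (congruentNumberCurve n).toAffine.Point, (2 : ℕ) • Q = 0 ∧ (congruentNumberCurve n).xSqClass Q = c := by
  haveI := isElliptic_congruentNumberCurve hn
  have hn0 : (n : ℚ) ≠ 0 := by exact_mod_cast hn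
  have hT0 : (congruentNumberCurve n).toAffine.Nonsingular 0 0 := (cn_nonsingular_iff hn _ _).mpr (by ring)
  have hTp : (congruentNumberCurve n).toAffine.Nonsingular n 0 := (cn_nonsingular_iff hn _ _).mpr (by ring)
  have hTm : (congruentNumberCurve n).toAffine.Nonsingular (-(n : ℚ)) 0 := (cn_nonsingular_iff hn _ _).mpr (by ring)
  rcases hc with rfl | rfl | rfl | rfl
  · exact ⟨0, nsmul_zero _, xSqClass_zero _⟩
  · refine ⟨_, two_nsmul_some_zero hT0, ?_⟩
    rw [xSqClass_some_of_eq_zero hT0 rfl, congruentNumberCurve_a₄,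
      show -((n : ℚ) ^ 2) = -1 * (n * n) by ring, sqClass_mul (by norm_num) (mul_ne_zero hn0 hn0),
      sqClass_mul_self, mul_one]
  · exact ⟨_, two_nsmul_some_zero hTp, xSqClass_some_of_ne_zero hTp hn0⟩
  · exact ⟨_, two_nsmul_some_zero hTm, xSqClass_some_of_ne_zero hTm (neg_ne_zero.mpr hn0)⟩

/-- **`4 ≤ #α(E_n(ℚ))`** for square-free `n > 1`: the four torsion classes `1, [−1], [n], [−n]` are distinct and attained.
[cite: SilvermanTate2015, §3.5] -/
theorem four_le_natCard_range_xSqClass {n : ℕ} (hsq : Squarefree n) (hn1 : 1 < n) :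
    4 ≤ Nat.card (Set.range (congruentNumberCurve n).xSqClass) := by
  have hn : n ≠ 0 := by omega
  haveI := isElliptic_congruentNumberCurve hn
  obtain ⟨h1, h2, h3, h12, h13, h23⟩ := sqClass_torsion_injective hsq hn1
  haveI : Finite (Set.range (congruentNumberCurve n).xSqClass) := by
    have h := (congruentNumberCurve n).natCard_range_xSqClass_mul
    exact Nat.finite_of_card_ne_zero (fun h0 => by
      rw [h0, zero_mul] at h; exact absurd h.symm (pow_ne_zero _ two_ne_zero))
  set T : Finset (SqUnits ℚ) := {1, sqClass (-1 : ℚ), sqClass (n : ℚ), sqClass (-(n : ℚ))} with hT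
  have hTcard : T.card = 4 := by
    rw [hT, Finset.card_insert_of_notMem, Finset.card_insert_of_notMem, Finset.card_insert_of_notMem,
      Finset.card_singleton]
    · simpa using h23
    · simp [h12, h13]
    · simp [Ne.symm h1, Ne.symm h2, Ne.symm h3]
  have hsub : (T : Set (SqUnits ℚ)) ⊆ Set.range (congruentNumberCurve n).xSqClass := by
    intro c hc
    simp only [hT, Finset.coe_insert, Finset.coe_singleton, Set.mem_insert_iff, Set.mem_singleton_iff] at hc
    obtain ⟨Q, -, hQ⟩ := exists_two_torsion_xSqClass_eq hn hc
    exact ⟨Q, hQ⟩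
  calc 4 = T.card := hTcard.symm
    _ = Nat.card (T : Set (SqUnits ℚ)) := by rw [Nat.card_coe_set_eq, Set.ncard_coe_finset]
    _ ≤ Nat.card (Set.range (congruentNumberCurve n).xSqClass) := Nat.card_mono (Set.toFinite _) hsub

/-- **A point whose `x`-class is a torsion class lies in `φ_n(A_n(ℚ)) + E_n[2]`**: translate by the `2`-torsion point with the
same class (`α` is a homomorphism) and use `mem_rhoSubgroup_of_sqClass_eq_one`. [cite: TianYuanZhang2017, §1 (ρ(n))]
[cite: SilvermanAEC2009, Prop. X.4.9] -/
theorem mem_rhoSubgroup_of_xSqClass_torsion {n : ℕ} (hn : n ≠ 0) (P : (congruentNumberCurve n).toAffine.Point)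
    (hP : (congruentNumberCurve n).xSqClass P = 1 ∨ (congruentNumberCurve n).xSqClass P = sqClass (-1 : ℚ) ∨
      (congruentNumberCurve n).xSqClass P = sqClass (n : ℚ) ∨ (congruentNumberCurve n).xSqClass P = sqClass (-(n : ℚ))) :
    P ∈ rhoSubgroup n := by
  haveI := isElliptic_congruentNumberCurve hn
  obtain ⟨Q, hQ2, hQ⟩ := exists_two_torsion_xSqClass_eq hn hP
  -- `α` is a homomorphism (the generic lemma carries the classical `DecidableEq`; `convert` bridges the instances)
  have hadd : (congruentNumberCurve n).xSqClass (P + Q) =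
      (congruentNumberCurve n).xSqClass P * (congruentNumberCurve n).xSqClass Q := by
    convert xSqClass_add (congruentNumberCurve n) P Q using 5
  have hPQ : P + Q ∈ rhoSubgroup n := by
    apply mem_rhoSubgroup_of_sqClass_eq_one hn
    rw [← xSqClass_eq_sqClass_descentRep, hadd, hQ, SqUnits.mul_self]
  have hQmem : Q ∈ rhoSubgroup n := AddSubgroup.subset_closure (Or.inr hQ2)
  have := (rhoSubgroup n).sub_mem hPQ hQmem
  rwa [add_sub_cancel_right] at this

/-- **`#α(E_n(ℚ)) = 4·2^{ρ(n)}` on the rank-one leaf, as a dichotomy**: for square-free `n > 1` with `rank E_n(ℚ) = 1`,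
`#α(E_n(ℚ)) = 4` if `ρ(n) = 0` and `= 8` if `ρ(n) ≠ 0` (`#α ∣ 2^{rank+2} = 8`, `#α ≥ 4`, and when `#α = 4` the image IS the set
of torsion classes, so every point lies in `φ_n(A_n(ℚ)) + E_n[2]`). [cite: TianYuanZhang2017, §1 (ρ(n))] [cite: SilvermanTate2015, §3.6] -/
theorem natCard_range_xSqClass_eq_of_rank_one {n : ℕ} (hsq : Squarefree n) (hn1 : 1 < n)
    (hr : haveI := isElliptic_congruentNumberCurve (show n ≠ 0 by omega); (congruentNumberCurve n).mordellWeilRank = 1) :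
    ((rhoSubgroup n).index = 1 → Nat.card (Set.range (congruentNumberCurve n).xSqClass) = 4) ∧
      ((rhoSubgroup n).index ≠ 1 → Nat.card (Set.range (congruentNumberCurve n).xSqClass) = 8) := by
  have hn : n ≠ 0 := by omega
  haveI := isElliptic_congruentNumberCurve hn
  have h4 := four_le_natCard_range_xSqClass hsq hn1
  have hαα := (congruentNumberCurve n).natCard_range_xSqClass_mul
  rw [hr] at hαα
  have hdvd : Nat.card (Set.range (congruentNumberCurve n).xSqClass) ∣ 2 ^ 3 := Dvd.intro _ hαα
  obtain ⟨j, hj, hjeq⟩ := (Nat.dvd_prime_pow Nat.prime_two).mp hdvd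
  refine ⟨fun h1 => ?_, fun h1 => ?_⟩
  · have hle := natCard_range_xSqClass_le_four_of_rhoIndex_eq_one hn h1
    interval_cases j <;> simp_all
  · by_contra h8
    have hle4 : Nat.card (Set.range (congruentNumberCurve n).xSqClass) = 4 := by
      interval_cases j <;> simp_all
    -- `#α = 4`: the image IS the set of the four torsion classes
    obtain ⟨k1, k2, k3, k12, k13, k23⟩ := sqClass_torsion_injective hsq hn1
    haveI : Finite (Set.range (congruentNumberCurve n).xSqClass) := Nat.finite_of_card_ne_zero (by omega)
    set T : Finset (SqUnits ℚ) := {1, sqClass (-1 : ℚ), sqClass (n : ℚ), sqClass (-(n : ℚ))} with hT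
    have hTcard : T.card = 4 := by
      rw [hT, Finset.card_insert_of_notMem, Finset.card_insert_of_notMem, Finset.card_insert_of_notMem,
        Finset.card_singleton]
      · simpa using k23
      · simp [k12, k13]
      · simp [Ne.symm k1, Ne.symm k2, Ne.symm k3]
    have hsub : (T : Set (SqUnits ℚ)) ⊆ Set.range (congruentNumberCurve n).xSqClass := by
      intro c hc
      simp only [hT, Finset.coe_insert, Finset.coe_singleton, Set.mem_insert_iff, Set.mem_singleton_iff] at hc
      obtain ⟨Q, -, hQ⟩ := exists_two_torsion_xSqClass_eq hn hc
      exact ⟨Q, hQ⟩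
    have heq : (T : Set (SqUnits ℚ)) = Set.range (congruentNumberCurve n).xSqClass := by
      apply Set.eq_of_subset_of_ncard_le hsub ?_ (Set.toFinite _)
      rw [Set.ncard_coe_finset, hTcard, ← Nat.card_coe_set_eq, hle4]
    -- hence every point lies in `rhoSubgroup n`, contradicting `index ≠ 1`
    apply h1
    rw [AddSubgroup.index_eq_one, eq_top_iff]
    intro P _
    apply mem_rhoSubgroup_of_xSqClass_torsion hn P
    have hPmem : (congruentNumberCurve n).xSqClass P ∈ (T : Set (SqUnits ℚ)) := by
      rw [heq]; exact ⟨P, rfl⟩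
    simpa only [hT, Finset.coe_insert, Finset.coe_singleton, Set.mem_insert_iff, Set.mem_singleton_iff] using hPmem

end Summit.BirchSwinnertonDyer.PrintCf2.PartnerSha

end
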